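import Summits.QuantumAdvantage.QuantumAdvantage.Theorems.SosSandwichPseudoBoundedAAClassicalCornerExponents
import HarnessLib

/-!
# Crux `PseudoBoundedAA` (stmt-QuantumAdvantage-15237, route SosSandwich) — in the route decl's OWN one-exponent currency
# `C·(ε/T)^c ≤ maxInf` the classical corner is SETTLED: admissible `c` are exactly `c ≥ 2`; on single Boolean trees exactly `c ≥ 1`

Support file (`--supports stmt-QuantumAdvantage-15237`).  The route decl `Theses.SosSandwich.PseudoBoundedAA` asks for
`∃ (c : ℕ) (C > 0), ∀ p ∈ K_T (T ≥ 1), 0 < ε ≤ Var[p] → ∃ i, C·(ε/T)^c ≤ Infᵢ[p]` — ONE natural exponent `c` for the ratio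
`ε/T`.  `…ClassicalCornerExponents.lean` calibrated the two-exponent laws `C·Var^a/T^b` on the classical corner `R_T`
(`{a ≥ 2, b ≥ 2} ⊆` admissible `⊆ {a ≥ 2, b ≥ 1}`, the strip being the `L²`-OSSS question).  In the decl's own
one-exponent shape there is no strip: this file proves

* **`classicalCorner_literal_iff`** — for `c : ℕ`: (`∃ C > 0, ∀ N T p ε, T ≥ 1 → p` a probability mixture of depth-`≤ T`
  trees on the cube `→ 0 < ε ≤ Var[p] → ∃ i, C·(ε/T)^c ≤ Infᵢ[p]`) **`↔ 2 ≤ c`** (`←`: the tree's `(2,2)` law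
  `16(ε/T)² ≤ maxInf`, `ε/T ≤ 1`; `→`: the `T = 1` averaging family `Var = 1/(4n)`, `Inf ≡ 1/n²` kills `c ≤ 1`);
* **`booleanTreeCorner_literal_iff`** — the same over single Boolean decision trees of depth `≤ T` **`↔ 1 ≤ c`**
  (`←`: OSSS `4ε/T ≤ maxInf`; `→`: the tribes calibrators kill `c = 0`).

So, measured in the route item's literal currency, the classical corner of PB-AA is completely calibrated — the sharp
exponent `c = 2` predicted by the card is attained AND optimal there — and the remaining content of the crux on `R_T` is nil;
all open content of PB-AA lies in `K_T ∖ R_T` (and, in the finer two-exponent currency, in the `L²`-OSSS strip).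

Honest label: calibration of a corner of an open conjecture; no registered stub, crux or summit is closed.
Sources: O'Donnell–Saks–Schramm–Servedio FOCS 2005 Thm 1.1/3.2; Aaronson–Ambainis arXiv:0911.0996 Conj. 6; O'Donnell 2014
§4.2 (tribes).
-/

set_option linter.dupNamespace false

noncomputable section

namespace Summit.QuantumAdvantage.QuantumAdvantage.Theorems.SosSandwich

open Finset Function
open Literature.Computability.Complexity Literature.Computability.QuantumComplexity

namespace ClassicalCornerCalibration

/-- **The classical corner in the route decl's one-exponent currency: admissible `c` are exactly `c ≥ 2`.**
[cite: OdonnellEtAl2005, Thm 3.2] [cite: AaronsonAmbainis2014, Conj. 6] -/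
theorem classicalCorner_literal_iff (c : ℕ) :
    (∃ C : ℝ, 0 < C ∧ ∀ (N T : ℕ) (p : MvPolynomial (Fin N) ℝ) (ε : ℝ), 1 ≤ T →
      (∃ (m : ℕ) (w : Fin m → ℝ) (t : Fin m → DecisionTree N),
        (∀ k, 0 ≤ w k) ∧ ∑ k, w k = 1 ∧ (∀ k, (t k).depth ≤ T) ∧
          ∀ x : Fin N → Bool, evalBool p x = ∑ k, w k * (if (t k).eval x = true then (1 : ℝ) else 0)) →
      0 < ε → ε ≤ boolVariance p → ∃ i : Fin N, C * (ε / T) ^ c ≤ influence i p) ↔ 2 ≤ c := by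
  constructor
  · rintro ⟨C, hC, h⟩
    by_contra hlt
    push Not at hlt
    -- the averaging family at `T = 1` with `n > 5/C`
    obtain ⟨n₀, hn₀⟩ := exists_nat_gt (5 / C)
    set n : ℕ := n₀ + 1 with hndef
    have hn : 1 ≤ n := by omega
    have hnR : (n : ℝ) = n₀ + 1 := by rw [hndef]; push_cast; ring
    have hn0 : (0 : ℝ) < n := by rw [hnR]; positivity
    have hnC : 5 < C * n := by
      rw [div_lt_iff₀ hC] at hn₀
      rw [hnR]; nlinarith
    obtain ⟨m, wt, t, hwt, hwt1, htd, hmix⟩ := linearFamily_mixture hn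
    have hV := SymmetricCorner.boolVariance_linearFamily hn
    have hε : (0 : ℝ) < 1 / (4 * n) := by positivity
    obtain ⟨i, hi⟩ := h n 1 _ (1 / (4 * n)) le_rfl ⟨m, wt, t, hwt, hwt1, htd, hmix⟩ hε (le_of_eq hV.symm)
    rw [SymmetricCorner.influence_linearFamily, Nat.cast_one, div_one] at hi
    -- `hi : C (1/(4n))^c ≤ 1/n²` with `c ≤ 1`
    interval_cases c
    · rw [pow_zero, mul_one] at hi
      have : 1 / (n : ℝ) ^ 2 ≤ 1 / n := by
        rw [div_le_div_iff₀ (by positivity) hn0]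
        have h1 : (1 : ℝ) ≤ n := by exact_mod_cast hn
        nlinarith
      have h2 : C ≤ 1 / n := hi.trans this
      rw [le_div_iff₀ hn0] at h2
      linarith
    · rw [pow_one] at hi
      have h2 : C * (1 / (4 * (n : ℝ))) * (n : ℝ) ^ 2 ≤ 1 := by
        have := mul_le_mul_of_nonneg_right hi (sq_nonneg (n : ℝ))
        rwa [div_mul_cancel₀ _ (by positivity)] at this
      have h3 : C * (1 / (4 * (n : ℝ))) * (n : ℝ) ^ 2 = C * n / 4 := by
        field_simp
      rw [h3] at h2
      linarith
  · intro hc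
    refine ⟨16, by norm_num, ?_⟩
    intro N T p ε hT hmix hε hεV
    obtain ⟨m, w, t, hw, hw1, htd, hp⟩ := hmix
    have hp' : ∀ x, evalBool p x = ∑ k ∈ Finset.univ, w k * (if (t k).eval x = true then (1 : ℝ) else 0) := hp
    have hv : 0 < boolVariance p := lt_of_lt_of_le hε hεV
    obtain ⟨i, hi⟩ := ClassicalCorner.exists_influence_ge_of_mixture_depth_le Finset.univ w (fun k _ => hw k)
      (le_of_eq hw1) t T (fun k _ => htd k) p hp' hv
    refine ⟨i, ?_⟩
    have hpb : PseudoBounded T p := ClassicalCorner.pseudoBounded_of_mixture w hw hw1 t T htd p hp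
    have hV : boolVariance p ≤ 1 / 4 := boolVariance_le_quarter hpb
    have hT1 : (1 : ℝ) ≤ (T : ℝ) := by exact_mod_cast hT
    have hT0 : (0 : ℝ) < (T : ℝ) := by linarith
    have hr0 : 0 ≤ ε / T := by positivity
    have hr1 : ε / T ≤ 1 := by
      rw [div_le_one hT0]; linarith
    have hpow : (ε / T) ^ c ≤ (ε / T) ^ 2 := pow_le_pow_of_le_one hr0 hr1 hc
    have h2 : 16 * (ε / T) ^ 2 ≤ influence i p := by
      have hεsq : ε ^ 2 ≤ boolVariance p ^ 2 := pow_le_pow_left₀ hε.le hεV 2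
      rw [div_pow, mul_div_assoc', div_le_iff₀ (by positivity)]
      calc 16 * ε ^ 2 ≤ 16 * boolVariance p ^ 2 := by linarith
        _ ≤ (T : ℝ) ^ 2 * influence i p := hi
        _ = influence i p * (T : ℝ) ^ 2 := mul_comm _ _
    linarith [mul_le_mul_of_nonneg_left hpow (by norm_num : (0 : ℝ) ≤ 16)]

/-- **Single Boolean trees in the one-exponent currency: admissible `c` are exactly `c ≥ 1`.**
[cite: OdonnellEtAl2005, Thm 1.1] [cite: ODonnell2014, §4.2] -/
theorem booleanTreeCorner_literal_iff (c : ℕ) :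
    (∃ C : ℝ, 0 < C ∧ ∀ (N T : ℕ) (p : MvPolynomial (Fin N) ℝ) (t : DecisionTree N) (ε : ℝ), 1 ≤ T →
      t.depth ≤ T → (∀ x : Fin N → Bool, evalBool p x = if t.eval x = true then (1 : ℝ) else 0) →
      0 < ε → ε ≤ boolVariance p → ∃ i : Fin N, C * (ε / T) ^ c ≤ influence i p) ↔ 1 ≤ c := by
  constructor
  · rintro ⟨C, hC, h⟩
    by_contra hlt
    push Not at hlt
    have hc0 : c = 0 := by omega
    subst hc0
    -- the tribes calibrator with `2^w > 2/C`
    obtain ⟨w₀, hw₀⟩ := exists_nat_gt (2 / C)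
    set w : ℕ := w₀ + 1 with hwdef
    have hw1 : 1 ≤ w := by omega
    have hwR : (w : ℝ) = w₀ + 1 := by rw [hwdef]; push_cast; ring
    have h2w : (w : ℝ) < (2 : ℝ) ^ w := by exact_mod_cast Nat.lt_two_pow_self
    have h2w0 : (0 : ℝ) < (2 : ℝ) ^ w := by positivity
    obtain ⟨p, -, h01, -, hvar, hinf⟩ := exists_tribes_calibrator hw1
    have hpos : (1 : ℕ) ≤ 2 ^ w * w := Nat.one_le_iff_ne_zero.mpr (by positivity)
    obtain ⟨t₁, ht₁, hd₁⟩ := DecisionTree.exists_computes_depth_le (fun x : Fin (2 ^ w * w) → Bool =>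
      decide (evalBool p x = 1))
    have hp : ∀ x, evalBool p x = if t₁.eval x = true then (1 : ℝ) else 0 := by
      intro x
      rw [ht₁ x]
      beta_reduce
      by_cases h1 : evalBool p x = 1
      · rw [decide_eq_true h1, if_pos rfl, h1]
      · rw [decide_eq_false h1, if_neg Bool.false_ne_true]
        exact (h01 x).resolve_right h1
    obtain ⟨i, hi⟩ := h (2 ^ w * w) (2 ^ w * w) p t₁ (3 / 16) hpos hd₁ hp (by norm_num) hvar
    rw [pow_zero, mul_one] at hi
    have h3 : C ≤ 2 / (2 : ℝ) ^ w := hi.trans (hinf i)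
    rw [le_div_iff₀ h2w0] at h3
    rw [div_lt_iff₀ hC] at hw₀
    nlinarith
  · intro hc
    refine ⟨4, by norm_num, ?_⟩
    intro N T p t ε hT htd hp hε hεV
    have hv : 0 < boolVariance p := lt_of_lt_of_le hε hεV
    have hpf : ∀ x, evalBool p x = realOf (fun x => t.eval x) x := fun x => by rw [hp x, realOf_apply]
    obtain ⟨j, hj⟩ := BooleanCorner.exists_influence_ge_of_decisionTree p (fun x => t.eval x) hpf hv
    have hD : (detQueryComplexity (fun x => t.eval x) : ℝ) ≤ T := by
      exact_mod_cast (detQueryComplexity_le_depth t (fun x => rfl)).trans htd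
    refine ⟨j, ?_⟩
    have hI := influence_nonneg j p
    have hT1 : (1 : ℝ) ≤ (T : ℝ) := by exact_mod_cast hT
    have hT0 : (0 : ℝ) < (T : ℝ) := by linarith
    have hbd : ∀ x, 0 ≤ evalBool p x ∧ evalBool p x ≤ 1 := by
      intro x; rw [hp x]; split_ifs <;> norm_num
    have hV : boolVariance p ≤ 1 / 4 := SymmetricCorner.boolVariance_le_quarter hbd
    have hr0 : 0 ≤ ε / T := by positivity
    have hr1 : ε / T ≤ 1 := by
      rw [div_le_one hT0]; linarith
    have hpow : (ε / T) ^ c ≤ (ε / T) ^ 1 := pow_le_pow_of_le_one hr0 hr1 hc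
    rw [pow_one] at hpow
    -- `4 ε / T ≤ 4 Var / T ≤ Inf_j`
    have hkey : 4 * boolVariance p ≤ (T : ℝ) * influence j p := by
      have : boolVariance p ≤ (T : ℝ) * influence j p / 4 :=
        hj.trans (div_le_div_of_nonneg_right (mul_le_mul_of_nonneg_right hD hI) (by norm_num))
      linarith
    have h1 : 4 * (ε / T) ≤ influence j p := by
      rw [mul_div_assoc', div_le_iff₀ hT0]
      nlinarith
    linarith [mul_le_mul_of_nonneg_left hpow (by norm_num : (0 : ℝ) ≤ 4)]

end ClassicalCornerCalibration

end Summit.QuantumAdvantage.QuantumAdvantage.Theorems.SosSandwich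

end
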